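import Mathlib.Analysis.SpecialFunctions.Pow.Integral
import Literature.Analysis.FluidPDE.PineauVicolOneSliceProofs
import Literature.Analysis.FluidPDE.ClassicalSolutionRegionRescale
import Literature.Analysis.FluidPDE.ClassicalTopPointRegularity
import HarnessLib

/-!
# Pineau–Vicol 2026, Theorem 1.9 — the printed proof: Proposition 9.5 from the CKN criterion

Analysis/FluidPDE proof file, second sibling of `PineauVicolOneSlice.lean` (the named fact
`Literature.Analysis.FluidPDE.pineauVicol2026_oneSlice_regularity`, B. Pineau, V. Vicol,
arXiv:2607.09619 (2026), Thm. 1.9). It renders the concluding step of the printed proof —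
**Proposition 9.5** (one time-slice regularity criterion for Type I solutions, p. 32–33), whose
proof reads: "(u, p) is a suitable weak solution of the 3D Navier–Stokes equations in the
parabolic cylinder `Q_{3/4}`, in the sense of [CKN] … only integrability as `t → 0⁻` needs to be
checked … We are thus justified to invoke the ε-regularity theorem for suitable weak solutions
[11, 44, 41, 40]: there exists a universal constant `ε_* > 0` such that if
`limsup_{r→0⁺} r⁻¹ ∫_{Q_r} |∇u|² ≤ ε_*`, then `(0,0)` is a regular point" — as a theorem about the
solutions of Theorem 1.9 **modulo its genuinely analytic inputs**, which enter as hypotheses on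
the parabolic zoom `(u_c, p_c) = (c u(c²·, c·), c² p(c²·, c·))`, `0 < c < 1` (the cylinder
`Q_c` blown up to the unit cylinder, where the tree's criterion `seregin2014_thm14_holds` lives):

* `∇u_c ∈ L²(Q₁)` (= `∇u ∈ L²(Q_c)`, the paper's "By (1.15) and Lemma 9.2 … `∇u ∈ L²_{x,t}(Q_{3/4})`"
  — Lemma 9.2 is the quantitative interior regularity step, not formalised);
* `p_c ∈ L^{3/2}(Q₁)` (the paper's pressure decomposition `p = p_loc + h` with Calderón–Zygmund
  and the maximum principle for the harmonic part, not formalised);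
* `sup_{0<r<1} r⁻¹ ∫∫_{Q_r} |∇u_c|² < ε` (the paper's (9.14)–(9.16): small vorticity at one
  self-similar time propagates (Lemma 9.4) and gives the dissipation bound (9.15)–(9.16); the
  elementary scaling glue (9.16) is `cknE_le_of_slice_bound` of `PineauVicolOneSliceProofs`).

What IS proved here (`pineauVicol_regular_of_zoom`): for a classical solution `(u, p)` of
Navier–Stokes (`ν = 1`, `f = 0`) on `[−1,0) × B₁` with the Type I bound (1.15), and `0 < c < 1`,
the zoom `(u_c, p_c)` is a classical solution on the open unit cylinder
(`IsClassicalNSSolutionOnRegion.pineauVicol_zoom`, tree `nsRescale_translate_of_isOpen`), it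
inherits the scale-invariant Type I bound (`norm_nsRescale_le_of_typeI`) and hence the class
`u_c ∈ L^∞_t L²_x(Q₁)` (`exists_lintegral_ball_enorm_sq_nsRescale_le`, from `|u_c(s,y)| ≤ C_u/|y|`
and the integrability of `|y|⁻²` on balls of `ℝ³`, Mathlib `integrableOn_ball_of_norm_le_rpow`);
so under the three displayed hypotheses the classical top-point criterion
`exists_bound_near_top_of_classical_of_cknE_lt` (`ClassicalTopPointRegularity`) bounds `u_c` on
some `Q(ϱ)`, and un-zooming gives the conclusion of Theorem 1.9 verbatim:
`∃ r > 0, ∃ M, ∀ t ∈ (−r², 0), ∀ x ∈ B_r, ‖u(t,x)‖ ≤ M` with `r = cϱ`.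

## References

* B. Pineau, V. Vicol, arXiv:2607.09619 (2026): Prop. 9.5 and its proof (p. 32–33), Lemma 9.2
  (p. 30), (1.15) (p. 8). [PineauVicol2026]
* G. Seregin, *Lecture Notes on Regularity Theory for the Navier–Stokes Equations* (2014),
  Ch. 6, Thm. 1.4. [Seregin2014]
* L. Caffarelli, R. Kohn, L. Nirenberg, Comm. Pure Appl. Math. 35 (1982), Prop. 2. [CKN1982]
-/

noncomputable section

open Set Metric Function Filter MeasureTheory TopologicalSpace
open _root_.Topology
open scoped ENNReal NNReal

namespace Literature.Analysis.FluidPDE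

/-! ### The parabolic zoom of the solutions of Theorem 1.9 -/

section Zoom

variable {u : ℝ → EuclideanSpace ℝ (Fin 3) → EuclideanSpace ℝ (Fin 3)}
  {p : ℝ → EuclideanSpace ℝ (Fin 3) → ℝ} {c Cu : ℝ}

/-- The unit cylinder is mapped into `(−1,0) × B₁` by `(s, y) ↦ (c²s, cy)` for `0 < c ≤ 1`.
[folklore] -/
theorem sq_mul_mem_Ioo_and_smul_mem_ball (hc : 0 < c) (hc1 : c ≤ 1) {s : ℝ}
    {y : EuclideanSpace ℝ (Fin 3)}
    (hsy : (s, y) ∈ parabolicCylinder 1 (0 : ℝ × EuclideanSpace ℝ (Fin 3))) :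
    c ^ 2 * s ∈ Ioo (-1 : ℝ) 0 ∧ c • y ∈ ball (0 : EuclideanSpace ℝ (Fin 3)) 1 := by
  rw [mem_parabolicCylinder] at hsy
  obtain ⟨⟨hs1, hs0⟩, hy⟩ := hsy
  simp only [Prod.fst_zero, Prod.snd_zero, one_pow, zero_sub, dist_zero_right] at hs1 hs0 hy
  have hc2 : 0 < c ^ 2 := by positivity
  have hc21 : c ^ 2 ≤ 1 := by nlinarith
  refine ⟨⟨?_, by nlinarith⟩, ?_⟩
  · nlinarith
  · rw [mem_ball_zero_iff, norm_smul, Real.norm_of_nonneg hc.le]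
    nlinarith [norm_nonneg y]

/-- **The zoom of a solution of Theorem 1.9 is a classical solution on the open unit cylinder**:
for `(u, p)` classical on `[−1,0) × B₁` (`ν = 1`, `f = 0`) and `0 < c ≤ 1`, the pair
`(u_c, p_c) = (nsRescale c u, nsRescalePressure c p)`, `u_c(s,y) = c u(c²s, cy)`,
`p_c(s,y) = c² p(c²s, cy)`, is a classical solution on `Q(0,1) = (−1,0) × B₁` (tree:
`IsClassicalNSSolutionOnRegion.nsRescale_translate_of_isOpen`, the parabolic zoom at fixed
viscosity; Leray 1934, §20). [cite: PineauVicol2026, proof of Prop. 9.5 (scaling to the unit cylinder), arXiv:2607.09619 p. 33] -/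
theorem IsClassicalNSSolutionOnRegion.pineauVicol_zoom
    (hreg : IsClassicalNSSolutionOnRegion
      (Ico (-1 : ℝ) 0 ×ˢ ball (0 : EuclideanSpace ℝ (Fin 3)) 1) 1 0 u p)
    (hc : 0 < c) (hc1 : c ≤ 1) :
    IsClassicalNSSolutionOnRegion (parabolicCylinder 1 (0 : ℝ × EuclideanSpace ℝ (Fin 3))) 1 0
      (nsRescale c u) (nsRescalePressure c p) := by
  have hO : IsOpen (Ioo (-1 : ℝ) 0 ×ˢ ball (0 : EuclideanSpace ℝ (Fin 3)) 1) :=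
    isOpen_Ioo.prod isOpen_ball
  have h1 := (hreg.mono_of_isOpen (prod_mono Ioo_subset_Ico_self Subset.rfl) hO)
    |>.nsRescale_translate_of_isOpen hO hc 0 0
  have eu : c • stPull (c ^ 2) c 0 (0 : EuclideanSpace ℝ (Fin 3)) u = nsRescale c u := by
    funext s y
    simp [stPull_apply, nsRescale_apply]
  have ep : c ^ 2 • stPull (c ^ 2) c 0 (0 : EuclideanSpace ℝ (Fin 3)) p = nsRescalePressure c p := by
    funext s y
    simp [stPull_apply, nsRescalePressure_apply]
  have ef : (c ^ 2 * c) • stPull (c ^ 2) c 0 (0 : EuclideanSpace ℝ (Fin 3))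
      (0 : ℝ → EuclideanSpace ℝ (Fin 3) → EuclideanSpace ℝ (Fin 3)) = 0 := by
    funext s y
    simp [stPull_apply]
  rw [eu, ep, ef] at h1
  refine h1.mono_of_isOpen (fun z hz => ?_) (isOpen_parabolicCylinder 1 0)
  obtain ⟨hs, hy⟩ := sq_mul_mem_Ioo_and_smul_mem_ball hc hc1 (s := z.1) (y := z.2) hz
  rw [mem_preimage]
  change (0 + c ^ 2 * z.1, (0 : EuclideanSpace ℝ (Fin 3)) + c • z.2) ∈
    Ioo (-1 : ℝ) 0 ×ˢ ball (0 : EuclideanSpace ℝ (Fin 3)) 1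
  rw [zero_add, zero_add]
  exact mk_mem_prod hs hy

/-- **The Type I bound is scale invariant**: under (1.15) on `[−1,0) × B₁`, the zoom `u_c`,
`0 < c ≤ 1`, satisfies `‖u_c(s, y)‖ ≤ C_u/(√(−s) + ‖y‖)` on the open unit cylinder. [cite: PineauVicol2026, (1.15), arXiv:2607.09619 p. 8] -/
theorem norm_nsRescale_le_of_typeI (hc : 0 < c) (hc1 : c ≤ 1)
    (hI : ∀ t ∈ Ico (-1 : ℝ) 0, ∀ x ∈ ball (0 : EuclideanSpace ℝ (Fin 3)) 1,
      ‖u t x‖ ≤ Cu / (Real.sqrt (-t) + ‖x‖))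
    {s : ℝ} {y : EuclideanSpace ℝ (Fin 3)}
    (hsy : (s, y) ∈ parabolicCylinder 1 (0 : ℝ × EuclideanSpace ℝ (Fin 3))) :
    ‖nsRescale c u s y‖ ≤ Cu / (Real.sqrt (-s) + ‖y‖) := by
  have hs0 : s < 0 := by simpa using (mem_parabolicCylinder.1 hsy).1.2
  obtain ⟨hs, hy⟩ := sq_mul_mem_Ioo_and_smul_mem_ball hc hc1 hsy
  have key := hI (c ^ 2 * s) ⟨hs.1.le, hs.2⟩ (c • y) hy
  have hsqrt : Real.sqrt (-(c ^ 2 * s)) = c * Real.sqrt (-s) := by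
    rw [show -(c ^ 2 * s) = c ^ 2 * (-s) by ring, Real.sqrt_mul' _ (by linarith),
      Real.sqrt_sq hc.le]
  rw [hsqrt, norm_smul, Real.norm_of_nonneg hc.le, ← mul_add] at key
  have hden : 0 < Real.sqrt (-s) + ‖y‖ := by
    have : 0 < Real.sqrt (-s) := Real.sqrt_pos.2 (by linarith)
    positivity
  rw [nsRescale_apply, norm_smul, Real.norm_of_nonneg hc.le]
  calc c * ‖u (c ^ 2 * s) (c • y)‖ ≤ c * (Cu / (c * (Real.sqrt (-s) + ‖y‖))) := by gcongr
    _ = Cu / (Real.sqrt (-s) + ‖y‖) := by field_simp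

/-- **`u_c ∈ L^∞_t L²_x(Q₁)` from the Type I bound** ("By (1.15) … we have `u ∈ L^∞_t L²_x`",
proof of Prop. 9.5): `|u_c(s, y)| ≤ C_u/|y|` on the unit cylinder and `|y|⁻²` is integrable on
balls of `ℝ³`, so `∫_{B₁} |u_c(s, ·)|² ≤ C_u² ∫_{B₁} |y|⁻² dy` for every `s ∈ (−1, 0)`. [cite: PineauVicol2026, proof of Prop. 9.5, arXiv:2607.09619 p. 33] -/
theorem exists_lintegral_ball_enorm_sq_nsRescale_le (hc : 0 < c) (hc1 : c ≤ 1)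
    (hI : ∀ t ∈ Ico (-1 : ℝ) 0, ∀ x ∈ ball (0 : EuclideanSpace ℝ (Fin 3)) 1,
      ‖u t x‖ ≤ Cu / (Real.sqrt (-t) + ‖x‖)) :
    ∃ C : ℝ≥0, ∀ s ∈ Ioo (-1 : ℝ) 0,
      ∫⁻ y in ball (0 : EuclideanSpace ℝ (Fin 3)) 1, ‖nsRescale c u s y‖ₑ ^ 2 ≤ C := by
  -- the majorant `C_u² |y|^{-2}` is integrable on the unit ball of `ℝ³`
  set g : EuclideanSpace ℝ (Fin 3) → ℝ := fun y => Cu ^ 2 * ‖y‖ ^ (-(2 : ℝ)) with hg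
  have hgi : IntegrableOn g (ball (0 : EuclideanSpace ℝ (Fin 3)) 1) volume := by
    refine integrableOn_ball_of_norm_le_rpow (by rw [finrank_euclideanSpace_fin]; norm_num)
      (C := Cu ^ 2) (α := 2) (by rw [finrank_euclideanSpace_fin]; norm_num)
      (Eventually.of_forall fun y => ?_) ?_
    · rw [hg, Real.norm_of_nonneg (by positivity)]
    · exact ((continuous_norm.measurable.pow_const _).const_mul _).aestronglyMeasurable
  have hg0 : ∀ y, 0 ≤ g y := fun y => by rw [hg]; positivity
  have hfin : ∫⁻ y in ball (0 : EuclideanSpace ℝ (Fin 3)) 1, ENNReal.ofReal (g y) < ⊤ := by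
    rw [← ofReal_integral_eq_lintegral_ofReal hgi (ae_of_all _ hg0)]
    exact ENNReal.ofReal_lt_top
  refine ⟨(∫⁻ y in ball (0 : EuclideanSpace ℝ (Fin 3)) 1, ENNReal.ofReal (g y)).toNNReal,
    fun s hs => ?_⟩
  rw [ENNReal.coe_toNNReal hfin.ne]
  -- pointwise a.e. bound on the ball (off the origin)
  have h0 : ∀ᵐ y ∂(volume.restrict (ball (0 : EuclideanSpace ℝ (Fin 3)) 1)), y ≠ 0 := by
    refine ae_restrict_of_ae ?_
    rw [ae_iff]
    simp
  refine lintegral_mono_ae ?_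
  filter_upwards [h0, ae_restrict_mem measurableSet_ball] with y hy0 hy
  have hsy : (s, y) ∈ parabolicCylinder 1 (0 : ℝ × EuclideanSpace ℝ (Fin 3)) := by
    rw [mem_parabolicCylinder]
    simpa using And.intro hs (mem_ball_zero_iff.1 hy)
  have h1 := norm_nsRescale_le_of_typeI hc hc1 hI hsy
  have hypos : 0 < ‖y‖ := norm_pos_iff.2 hy0
  have hCu : 0 ≤ Cu := by
    have := (norm_nonneg _).trans h1
    have hden : 0 < Real.sqrt (-s) + ‖y‖ := by positivity
    exact (div_nonneg_iff.1 this).elim (fun h => h.1) fun h => absurd h.2 (not_le.2 hden)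
  have h2 : ‖nsRescale c u s y‖ ≤ Cu / ‖y‖ := by
    refine h1.trans (div_le_div_of_nonneg_left hCu hypos ?_)
    linarith [Real.sqrt_nonneg (-s)]
  have h3 : ‖nsRescale c u s y‖ ^ 2 ≤ g y := by
    show ‖nsRescale c u s y‖ ^ 2 ≤ Cu ^ 2 * ‖y‖ ^ (-(2 : ℝ))
    have : (Cu / ‖y‖) ^ 2 = Cu ^ 2 * ‖y‖ ^ (-(2 : ℝ)) := by
      rw [Real.rpow_neg (norm_nonneg _), Real.rpow_two, div_pow, div_eq_mul_inv]
    rw [← this]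
    exact pow_le_pow_left₀ (norm_nonneg _) h2 2
  calc ‖nsRescale c u s y‖ₑ ^ 2 = ENNReal.ofReal (‖nsRescale c u s y‖ ^ 2) := by
        rw [← ofReal_norm, ENNReal.ofReal_pow (norm_nonneg _)]
    _ ≤ ENNReal.ofReal (g y) := ENNReal.ofReal_le_ofReal h3

end Zoom

/-! ### Proposition 9.5 modulo its analytic inputs -/

/-- **Pineau–Vicol 2026, Prop. 9.5 from the CKN criterion, for the solutions of Theorem 1.9,
modulo the analytic inputs.** There is a universal `ε > 0` (that of the backward CKN criterion,
`seregin2014_thm14_holds`) such that: for every classical solution `(u, p)` of Navier–Stokes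
(`ν = 1`, `f = 0`) on `[−1,0) × B₁` with the Type I bound (1.15), and every zoom factor
`0 < c < 1`, IF the zoom `(u_c, p_c) = (c u(c²·, c·), c² p(c²·, c·))` has `∇u_c ∈ L²(Q₁)`
(⇐ Lemma 9.2) and `p_c ∈ L^{3/2}(Q₁)` (⇐ the pressure decomposition in the proof of Prop. 9.5)
and small dissipation `sup_{0<r<1} r⁻¹∫∫_{Q_r}|∇u_c|² < ε` (⇐ (9.14)–(9.16) via Lemma 9.4), THEN
`(0,0)` is a regular point in the sense of footnote 12 / the conclusion of the vendored fact:
`u` is bounded on `B_r × (−r², 0)` for some `r > 0` (here `r = cϱ`). The interior suitability of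
`(u_c, p_c)` ("in the sense of [CKN]") and the class `u_c ∈ L^∞_t L²_x` are proved, not assumed.
[cite: PineauVicol2026, Prop. 9.5 and its proof, arXiv:2607.09619 p. 32–33] -/
theorem pineauVicol_regular_of_zoom :
    ∃ ε : ℝ, 0 < ε ∧
      ∀ (u : ℝ → EuclideanSpace ℝ (Fin 3) → EuclideanSpace ℝ (Fin 3))
        (p : ℝ → EuclideanSpace ℝ (Fin 3) → ℝ) (Cu c : ℝ),
        IsClassicalNSSolutionOnRegion
          (Ico (-1 : ℝ) 0 ×ˢ ball (0 : EuclideanSpace ℝ (Fin 3)) 1) 1 0 u p →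
        (∀ t ∈ Ico (-1 : ℝ) 0, ∀ x ∈ ball (0 : EuclideanSpace ℝ (Fin 3)) 1,
          ‖u t x‖ ≤ Cu / (Real.sqrt (-t) + ‖x‖)) →
        0 < c → c < 1 →
        (∫⁻ w in parabolicCylinder 1 (0 : ℝ × EuclideanSpace ℝ (Fin 3)),
          ENNReal.ofReal (frobeniusNormSq (fderiv ℝ (nsRescale c u w.1) w.2)) < ⊤) →
        MemLp (uncurry (nsRescalePressure c p)) (3 / 2)
          (volume.restrict (parabolicCylinder 1 (0 : ℝ × EuclideanSpace ℝ (Fin 3)))) →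
        (⨆ r ∈ Ioo (0 : ℝ) 1,
          cknE r (0 : ℝ × EuclideanSpace ℝ (Fin 3)) (fun t x => fderiv ℝ (nsRescale c u t) x)) <
            ENNReal.ofReal ε →
        ∃ r : ℝ, 0 < r ∧ ∃ M : ℝ, ∀ t : ℝ, -r ^ 2 < t → t < 0 →
          ∀ x ∈ ball (0 : EuclideanSpace ℝ (Fin 3)) r, ‖u t x‖ ≤ M := by
  obtain ⟨ε, hε, H⟩ := exists_bound_near_top_of_classical_of_cknE_lt
  refine ⟨ε, hε, fun u p Cu c hreg hI hc hc1 hG hq hE => ?_⟩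
  have hzoom := hreg.pineauVicol_zoom hc hc1.le
  have hL2 := exists_lintegral_ball_enorm_sq_nsRescale_le hc hc1.le hI
  obtain ⟨ϱ, hϱ, M, hM⟩ := H (nsRescale c u) (nsRescalePressure c p) hzoom hL2 hG hq hE
  refine ⟨c * ϱ, mul_pos hc hϱ.1, c⁻¹ * M, fun t ht1 ht0 x hx => ?_⟩
  -- un-zoom: `u = nsRescale c⁻¹ u_c`
  have hu : u t x = c⁻¹ • nsRescale c u ((c⁻¹) ^ 2 * t) (c⁻¹ • x) := by
    have := congrFun (congrFun (nsRescale_inv_nsRescale hc.ne' u) t) x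
    rw [← this, nsRescale_apply]
  have hmem : ((c⁻¹) ^ 2 * t, c⁻¹ • x) ∈
      parabolicCylinder ϱ (0 : ℝ × EuclideanSpace ℝ (Fin 3)) := by
    rw [mem_parabolicCylinder]
    simp only [Prod.fst_zero, Prod.snd_zero, zero_sub, dist_zero_right]
    have hci : 0 < c⁻¹ := inv_pos.2 hc
    refine ⟨⟨?_, ?_⟩, ?_⟩
    · -- `-(ϱ²) < c⁻² t` from `-(cϱ)² < t`
      have h1 : (c⁻¹) ^ 2 * (-(c * ϱ) ^ 2) = -ϱ ^ 2 := by field_simp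
      have h2 : (c⁻¹) ^ 2 * (-(c * ϱ) ^ 2) < (c⁻¹) ^ 2 * t :=
        mul_lt_mul_of_pos_left ht1 (by positivity)
      linarith
    · exact mul_neg_of_pos_of_neg (by positivity) ht0
    · rw [norm_smul, Real.norm_of_nonneg hci.le]
      rw [mem_ball_zero_iff] at hx
      calc c⁻¹ * ‖x‖ < c⁻¹ * (c * ϱ) := by gcongr
        _ = ϱ := by field_simp
  have key := hM _ hmem
  rw [hu, norm_smul, Real.norm_of_nonneg (inv_pos.2 hc).le]
  gcongr

end Literature.Analysis.FluidPDE

end
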